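import Summits.NavierStokesRegularity.NavierStokesRegularity.Theses.AxisymmetricExtremality
import Summits.NavierStokesRegularity.NavierStokesRegularity.Theorems.AxisymmetricLiouvilleBoundedSwirl
import Literature.Analysis.FluidPDE.RusinSverakCompactness
import Literature.Analysis.FluidPDE.SelfSimilar
import Literature.Analysis.FluidPDE.KatoMaximalTime
import Literature.Analysis.FluidPDE.AxisymmetricEuler
import Literature.Analysis.FluidPDE.SpaceTimeRescaling

/-!
# Strategist s19-g2 — typed candidate signatures for the STRATEGY CENSUS of the crux
# `AxisymmetricExtremality.AxisymmetricKatoGlobal` (stmt-NavierStokesRegularity-15453)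

Scratch only (census exhibits); nothing here is proposed to the tree.  Each `def` is a candidate
replacement / piece / strengthening examined in `STRATEGY-CENSUS-s19-g2.md`; the two `theorem`s are
the trivial logical seams recorded there (W1 seam needs the route's other items and is NOT provable
from W1 alone — see the census).
-/

noncomputable section

open Set MeasureTheory Filter Topology Function Metric
open scoped ENNReal NNReal
open Literature.Analysis.FluidPDE Literature.Analysis.FunctionSpaces

namespace Summit.NavierStokesRegularity.NavierStokesRegularity.Cruxes.AxisymmetricKatoGlobal.StrategistS19g2

set_option linter.unusedVariables false

local notation "ℝ³" => EuclideanSpace ℝ (Fin 3)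

/-- **W1** (candidate strictly-weaker intermediate): Rusin–Šverák's set `M(ν)` of `Ḣ^{1/2}`-norm-minimal
blow-up data contains no axisymmetric element. -/
def NoAxisymMinimalBlowupDatum : Prop :=
  ∀ ν : ℝ, 0 < ν → ¬ ∃ (u₀ : ℝ³ → ℝ³) (g : HomSobolev ℝ³ (EuclideanSpace ℂ (Fin 3)) (1 / 2 : ℝ)),
    IsMinimalBlowupDatum ν u₀ g ∧ IsAxisymmetric u₀

/-- **W2** (candidate weaker intermediate, the base case of a swirl-size induction): PURE small-swirl
global regularity in Kato's class — an absolute `δ > 0` such that `sup |r u₀^θ| ≤ δ ν` forces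
`T_max = ∞` (only RELATIVE smallness is in print: Lei–Zhang 2017 Thm 1.4, Chen–Fang–Zhang 2017). -/
def SmallSwirlGlobal : Prop :=
  ∃ δ : ℝ, 0 < δ ∧ ∀ ν : ℝ, 0 < ν → ∀ (u₀ : ℝ³ → ℝ³)
    (g : HomSobolev ℝ³ (EuclideanSpace ℂ (Fin 3)) (1 / 2 : ℝ)),
    MemLp u₀ 3 volume → g.Represents (Literature.Analysis.FunctionSpaces.EuclideanSpace.complexify ∘ u₀) →
    IsWeaklyDivFree u₀ → IsAxisymmetric u₀ → (∀ x, |swirl u₀ x| ≤ δ * ν) → HasGlobalKatoSolution ν u₀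

/-- **S⁺** (strengthen-to-induct candidate): a uniform HÖLDER modulus of the swirl at the axis up to the
final time (Chen–Fang–Zhang's hypothesis made a priori); strictly stronger than the lead's registered
`stub_swirlAxisModulus` (log⁻³ modulus). -/
def SwirlAxisHolder : Prop :=
  ∀ ν : ℝ, 0 < ν → ∀ T : ℝ, 0 < T → ∀ (u₀ : ℝ³ → ℝ³)
    (g : HomSobolev ℝ³ (EuclideanSpace ℂ (Fin 3)) (1 / 2 : ℝ)) (u : ℝ → ℝ³ → ℝ³),
    g.Represents (Literature.Analysis.FunctionSpaces.EuclideanSpace.complexify ∘ u₀) →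
    IsKatoSolutionOn T ν u₀ u → ContDiffOn ℝ (⊤ : ℕ∞) (uncurry u) (Ioo 0 T ×ˢ univ) →
    (∀ t ∈ Ioo 0 T, IsAxisymmetric (u t)) →
    ∀ t₀ ∈ Ioo 0 T, ∃ C α δ₀ : ℝ, 0 < α ∧ 0 < δ₀ ∧ δ₀ < 1 ∧
      ∀ t ∈ Ico t₀ T, ∀ x : ℝ³, cylRadius x ≤ δ₀ → |swirl (u t) x| ≤ C * cylRadius x ^ α

/-- **D-piece `NoConstantInnerObject`** (the (α)-branch of the landed velocity-scale dichotomy, typed over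
Kato's class): no axisymmetric Kato solution on `[0, T)` admits gauge times `tₖ ↑ T`, scales `λₖ ↓ 0`
with `(λₖ/ν)|u| ≤ 1` up to `tₖ`, centres `cₖ` with `(λₖ/ν)|u(tₖ,cₖ)| → 1`, whose zoom converges slice-wise
locally uniformly to a NON-ZERO CONSTANT.  With (AX-L) (`AxisymmetricLiouvilleBoundedSwirl`, tree
conjecture) this is the second half of the only honest split found; see the census for why it keeps
the whole difficulty. -/
def NoConstantInnerObject : Prop :=
  ∀ ν : ℝ, 0 < ν → ∀ T : ℝ, 0 < T → ∀ (u₀ : ℝ³ → ℝ³) (u : ℝ → ℝ³ → ℝ³),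
    IsKatoSolutionOn T ν u₀ u → ContDiffOn ℝ (⊤ : ℕ∞) (uncurry u) (Ioo 0 T ×ˢ univ) →
    (∀ t ∈ Ioo 0 T, IsAxisymmetric (u t)) →
    ∀ (tn lamn : ℕ → ℝ) (cn : ℕ → ℝ³) (c : ℝ³),
      (∀ k, T / 2 ≤ tn k ∧ tn k < T) → Tendsto tn atTop (𝓝 T) →
      (∀ k, 0 < lamn k) → Tendsto lamn atTop (𝓝 0) →
      (∀ k, ∀ t ∈ Icc (T / 2) (tn k), ∀ x, lamn k / ν * ‖u t x‖ ≤ 1) →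
      Tendsto (fun k => lamn k / ν * ‖u (tn k) (cn k)‖) atTop (𝓝 1) →
      ‖c‖ = 1 →
      (∀ s < 0, TendstoLocallyUniformly
        (fun k => ((lamn k / ν) • stPull (lamn k ^ 2 / ν) (lamn k) (tn k) (cn k) u) s) (fun _ => c) atTop) →
      False

/-- **Negation target** (what a counterexample must be, by the landed constraints): an axisymmetric
datum in the crux's class WITH swirl and finite Kato lifespan. -/
def AxisymKatoBlowupExists : Prop :=
  ∃ ν : ℝ, 0 < ν ∧ ∃ (u₀ : ℝ³ → ℝ³) (g : HomSobolev ℝ³ (EuclideanSpace ℂ (Fin 3)) (1 / 2 : ℝ)),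
    MemLp u₀ 3 volume ∧ g.Represents (Literature.Analysis.FunctionSpaces.EuclideanSpace.complexify ∘ u₀) ∧
    IsWeaklyDivFree u₀ ∧ IsAxisymmetric u₀ ∧ ¬ HasNoSwirl u₀ ∧ ¬ HasGlobalKatoSolution ν u₀

/-- Seam: the negation target refutes the crux (pure logic; the symmetry clause of the crux is
`IsAxisymmetric u₀` by `Iff.rfl`). -/
theorem not_crux_of_blowup (h : AxisymKatoBlowupExists) :
    ¬ Theses.AxisymmetricExtremality.AxisymmetricKatoGlobal := by
  rintro hc
  obtain ⟨ν, hν, u₀, g, h3, hrep, hdiv, hax, -, hng⟩ := h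
  exact hng (hc ν hν u₀ g h3 hrep hdiv (fun θ x => hax θ x))

/-- Seam: the crux implies W1 (W1 is a CONSEQUENCE of the crux — the converse is the issue). -/
theorem noAxisymMinimal_of_crux (hc : Theses.AxisymmetricExtremality.AxisymmetricKatoGlobal) :
    NoAxisymMinimalBlowupDatum := by
  rintro ν hν ⟨u₀, g, ⟨h3, hrep, hdiv, -, hng⟩, hax⟩
  exact hng (hc ν hν u₀ g h3 hrep hdiv (fun θ x => hax θ x))

/-- Seam: S⁺ implies the lead's registered stub 3 statement shape pointwise (Hölder ⇒ log⁻³ near the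
axis) — recorded informally in the census; the elementary real inequality `r^α ≤ C'/|log r|³` on
`(0, δ₀]` is not reproduced here. -/
example : True := trivial

end Summit.NavierStokesRegularity.NavierStokesRegularity.Cruxes.AxisymmetricKatoGlobal.StrategistS19g2

end
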